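import Summits.ResolutionOfSingularities.ResolutionOfSingularities.Theorems.ValuativeLuAlphaPTorsorLogPrincipalizationDimTwo
import Summits.ResolutionOfSingularities.ResolutionOfSingularities.Theorems.ValuativeLuAlphaPTorsorLowDim
import Literature.AlgebraicGeometry.Resolution.ValuedFunctionFields

/-!
# `LuAlphaPTorsor` along valuations centred in codimension `≤ 2` (stub E of the line)

Crux `Valuative.LuAlphaPTorsor` (item `stmt-ResolutionOfSingularities-0641`), line
`pfaff-line-log-final-forms`. With Mon_ν(2) landed (`logPrincipalization_of_ringKrullDim_le_two`,
Giraud 1983 Thm. 2.4 along a valuation, arbitrary ground field), the line's composition closes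
the crux whenever the centre of the valuation on the regular base has codimension `≤ 2`:

* `luAlphaPTorsor_of_ringKrullDim_le_two` — the headline, unconditional (all `k` of
  characteristic `p`, all `p`, all valuation ranks): `t^p` a `p`-th power at the centre →
  birational exit; otherwise Mon_ν(2) gives a model `A₁` with monomial logarithmic content,
  `stub_pthPowerModMonomial` the congruence `t^p ≡ c^p (mod u_E^M)`, `stub_finalFormExits` the
  trichotomy, and the landed birational / monogenic / toroidal exits the regular model;
* `stub_dimTwoImmediate` — the registered stub E of the gen-2 skeleton (base dimension `2`,
  immediate/defect case), now a special case (its immediacy and non-Abhyankar hypotheses are not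
  needed).

This is the first unconditional instance of the crux beyond Abhyankar places / `trdeg ≤ 1` /
discrete or defectless special cases: exactly the range (centre of codimension two,
non-Abhyankar `ν`, `t ∉ Frac A₀`, dense value group allowed) where the standing disproof file
locates the first possible counterexample.
-/

set_option linter.dupNamespace false

namespace Summit.ResolutionOfSingularities.ResolutionOfSingularities.Theorems.PfaffLine

open IsLocalRing

/-- **`LuAlphaPTorsor` along valuations whose centre on the regular base has codimension `≤ 2`.**
For `k` of characteristic `p`, `O` a valuation ring of `K ⊇ k`, `A₀ ⊆ O` finitely generated and
regular at the centre, `t^p ∈ A₀` with `Frac (A₀[t]) = K`: if the local ring of `A₀` at the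
centre has Krull dimension `≤ 2`, then some finitely generated `A ⊇ A₀[t]` inside `O` with
`Frac A = K` is regular at the centre. Proof: the line `pfaff-line-log-final-forms` — birational
exit if `t^p` is a `p`-th power at the centre; otherwise Mon_ν(2)
(`logPrincipalization_of_ringKrullDim_le_two`, Giraud 1983 Thm. 2.4 along `ν`), then
`stub_pthPowerModMonomial`, `stub_finalFormExits` and the three landed exits.
[cite: Giraud1983, Thm. 2.4] -/
theorem luAlphaPTorsor_of_ringKrullDim_le_two :
    ∀ p : ℕ, p.Prime → ∀ (k K : Type) [Field k] [CharP k p] [Field K] [Algebra k K] (O : ValuationSubring K) (A₀ : Subalgebra k K) (h₀ : A₀.toSubring ≤ O.toSubring) (t : K), A₀.FG → t ^ p ∈ A₀ → IsFractionRing (Algebra.adjoin k (insert t (A₀ : Set K))) K → IsRegularLocalRing (Localization.AtPrime (Ideal.comap (Subring.inclusion h₀) (IsLocalRing.maximalIdeal O))) → ringKrullDim (Localization.AtPrime (Ideal.comap (Subring.inclusion h₀) (IsLocalRing.maximalIdeal O))) ≤ 2 → ∃ (A : Subalgebra k K) (h : A.toSubring ≤ O.toSubring), A₀ ≤ A ∧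 t ∈ A ∧ A.FG ∧ IsFractionRing A K ∧ IsRegularLocalRing (Localization.AtPrime (Ideal.comap (Subring.inclusion h) (IsLocalRing.maximalIdeal O))) := by
  intro p hp k K _ _ _ _ O A₀ h₀ t hfg htp hfr hreg hdim
  by_cases hpow : ∃ c : Localization.AtPrime (Ideal.comap (Subring.inclusion h₀)
      (IsLocalRing.maximalIdeal O)), algebraMap A₀.toSubring (Localization.AtPrime
        (Ideal.comap (Subring.inclusion h₀) (IsLocalRing.maximalIdeal O))) ⟨t ^ p, htp⟩ = c ^ p
  · exact stub_birationalExit p hp k K O A₀ h₀ t hfg htp hfr hreg hpow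
  · push Not at hpow
    obtain ⟨A₁, h₁, hle, hA₁fg, hA₁reg, d, u, E, M, hspan, hdimd, hcontent⟩ :=
      logPrincipalization_of_ringKrullDim_le_two p hp k K O A₀ h₀ t hfg htp hfr hreg hdim hpow
    have hfr₁ : IsFractionRing (Algebra.adjoin k (insert t (A₁ : Set K))) K :=
      Literature.AlgebraicGeometry.Resolution.isFractionRing_of_le (adjoin_insert_mono' hle t) hfr
    have htp₁ : t ^ p ∈ A₁ := hle htp
    obtain ⟨c, hc⟩ := stub_pthPowerModMonomial p hp k K O A₁ h₁ hA₁fg hA₁reg _ d u E M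
      ⟨hspan, hdimd⟩ hcontent.le
    rcases stub_finalFormExits p hp k K O A₁ h₁ hA₁fg hA₁reg _ c d u E M ⟨hspan, hdimd⟩ hcontent hc
      with hPR | hT
    · rcases hPR with hP | hR
      · obtain ⟨A, h, hle₁, ht, hAfg, hAfr, hAreg⟩ :=
          stub_birationalExit p hp k K O A₁ h₁ t hA₁fg htp₁ hfr₁ hA₁reg hP
        exact ⟨A, h, hle.trans hle₁, ht, hAfg, hAfr, hAreg⟩
      · obtain ⟨A, h, hle₁, ht, hAfg, hAfr, hAreg⟩ :=
          stub_monogenicExit p hp k K O A₁ h₁ t hA₁fg htp₁ hfr₁ hA₁reg hR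
        exact ⟨A, h, hle.trans hle₁, ht, hAfg, hAfr, hAreg⟩
    · obtain ⟨A, h, hle₁, ht, hAfg, hAfr, hAreg⟩ :=
        stub_toroidalExit p hp k K O A₁ h₁ t hA₁fg htp₁ hfr₁ hA₁reg hT
      exact ⟨A, h, hle.trans hle₁, ht, hAfg, hAfr, hAreg⟩

/-- **Registered stub E `stub_dimTwoImmediate` of the line `pfaff-line-log-final-forms`**
(base dimension `2`, the immediate = defect case: every approximation of `t` in
`K₀ = Frac A₀` can be improved, `t^p` not a `p`-th power at the centre, `ν` not an Abhyankar
place with separable residue extension): the crux's conclusion holds. A special case of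
`luAlphaPTorsor_of_ringKrullDim_le_two` — the last three hypotheses are not used.
[cite: Giraud1983, Thm. 2.4] -/
theorem stub_dimTwoImmediate :
    ∀ p : ℕ, p.Prime → ∀ (k K : Type) [Field k] [CharP k p] [Field K] [Algebra k K] (O : ValuationSubring K) (A₀ : Subalgebra k K) (h₀ : A₀.toSubring ≤ O.toSubring) (t : K), A₀.FG → ∀ (htp : t ^ p ∈ A₀), IsFractionRing (Algebra.adjoin k (insert t (A₀ : Set K))) K → IsRegularLocalRing (Localization.AtPrime (Ideal.comap (Subring.inclusion h₀) (IsLocalRing.maximalIdeal O))) → ringKrullDim (Localization.AtPrime (Ideal.comap (Subring.inclusion h₀) (IsLocalRing.maximalIdeal O))) = 2 → (∀ c : Localization.AtPrime (Ideal.comap (Subring.inclusion h₀) (IsLocalRing.maximalIdeal O)), algebraMap A₀.toSubring (Localization.AtPrime (Ideal.comap (Subring.inclusion h₀) (IsLocalRing.maximalIdeal O))) ⟨t ^ p, htp⟩ ≠ c ^ p) → ¬ (Literature.AlgebraicGeometry.Resolution.IsAbhyankarPlace O (algebraMap k K).fieldRange ⊤ ∧ Literature.AlgebraicGeometry.Resolution.SeparablyGeneratedOver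 (Literature.AlgebraicGeometry.Resolution.resField O (algebraMap k K).fieldRange) (Literature.AlgebraicGeometry.Resolution.resField O ⊤)) → (∀ c : K, c ∈ Subfield.closure (A₀ : Set K) → ∃ c' : K, c' ∈ Subfield.closure (A₀ : Set K) ∧ O.valuation (t - c') < O.valuation (t - c)) → ∃ (A : Subalgebra k K) (h : A.toSubring ≤ O.toSubring), A₀ ≤ A ∧ t ∈ A ∧ A.FG ∧ IsFractionRing A K ∧ IsRegularLocalRing (Localization.AtPrime (Ideal.comap (Subring.inclusion h) (IsLocalRing.maximalIdeal O))) := by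
  intro p hp k K _ _ _ _ O A₀ h₀ t hfg htp hfr hreg hdim _ _ _
  exact luAlphaPTorsor_of_ringKrullDim_le_two p hp k K O A₀ h₀ t hfg htp hfr hreg hdim.le

end Summit.ResolutionOfSingularities.ResolutionOfSingularities.Theorems.PfaffLine
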